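import Summits.NavierStokesRegularity.NavierStokesRegularity.Theses.QuantisedSymmetry
import Summits.NavierStokesRegularity.NavierStokesRegularity.Theses.DssFarFieldSlaving
import Summits.NavierStokesRegularity.NavierStokesRegularity.Theorems.QuantisedSymmetryPolyhedralTruncationBridge
import Summits.NavierStokesRegularity.NavierStokesRegularity.Theorems.QuantisedSymmetryLiouvilleKillsProfile
import Summits.NavierStokesRegularity.NavierStokesRegularity.Theorems.QuantisedSymmetryPolyhedralDssProfileExistsDominatesBlowupProfile
import Summits.NavierStokesRegularity.NavierStokesRegularity.Theorems.DssFarFieldSlavingDssTruncationBridge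
import HarnessLib

/-!
# Strategist sketch s21-g2 (family `s`, gen 2, INDEPENDENT census) for crux
`QuantisedSymmetry.PolyhedralDssProfileExists` (stmt-NavierStokesRegularity-1404).

Kernel-checked bookkeeping behind `STRATEGY-CENSUS-s21.md`:

* `W0`: the crux ALONE decides the summit negatively — every co-binder of the route's `closes`
  is a landed theorem, so `PolyhedralDssProfileExists → ¬ NavierStokesRegularity` holds in the tree.
* `W1`/`W2`: the G-free weakening (stmt-0155, `BlowupTypeIDssProfile`) is implied by the crux AND
  still decides the summit (both arrows landed) — so "weaken by dropping G" is not a step short of the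
  summit, it is a sibling route's deciding crux.
* `D1`–`D3`: the best typed decomposition found (existence of a nontrivial bounded ancient
  G-equivariant Type-I solution = ¬PolyhedralTypeILiouville, plus a SELECTION piece ancient ⇒
  scale-periodic), with the assembly proved and `crux → ExistencePiece` proved from the landed
  kill-switch glue; recorded as NOT a redirect because neither piece has a plan (census §Decomposition).

No `sorry`; nothing here is proposed to Theorems/ (strategist evidence only).
-/

namespace Summit.NavierStokesRegularity.NavierStokesRegularity.Cruxes.PolyhedralDssProfileExists.S21g2

open Summit.NavierStokesRegularity.NavierStokesRegularity.Theses

/-- **W0.** The crux alone refutes the summit: `closes` with its two other binders discharged by the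
landed `quantisedSymmetry_polyhedralTruncationBridge_proof` (stmt-11331) and `ClayUniqueness_holds`
(stmt-0153). -/
theorem not_navierStokesRegularity_of_crux
    (hX : QuantisedSymmetry.PolyhedralDssProfileExists) : ¬ _root_.NavierStokesRegularity :=
  QuantisedSymmetry.closes hX
    _root_.Summit.NavierStokesRegularity.NavierStokesRegularity.Theorems.quantisedSymmetry_polyhedralTruncationBridge_proof
    QuantisedSymmetry.ClayUniqueness_holds

/-- **W1.** The crux implies the G-free Type-I (R)DSS profile statement stmt-0155 (as typed on route
DssFarFieldSlaving; definitionally the same as `Blowup.BlowupTypeIDssProfile`). -/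
theorem blowupTypeIDssProfile_of_crux
    (hX : QuantisedSymmetry.PolyhedralDssProfileExists) : DssFarFieldSlaving.BlowupTypeIDssProfile :=
  _root_.Summit.NavierStokesRegularity.NavierStokesRegularity.Theorems.PolyhedralDssProfileExists.PolyhedralCell.stub_dominatesBlowupProfile hX

/-- **W2.** … and stmt-0155 ALSO decides the summit on its own (landed `dssTruncationBridge_proof` +
`DssFarFieldSlaving.closes`): dropping the symmetry group is not a weakening short of the summit. -/
theorem not_navierStokesRegularity_of_blowupTypeIDssProfile
    (hP : DssFarFieldSlaving.BlowupTypeIDssProfile) : ¬ _root_.NavierStokesRegularity :=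
  DssFarFieldSlaving.closes
    _root_.Summit.NavierStokesRegularity.NavierStokesRegularity.Theorems.dssTruncationBridge_proof hP

/-- **D1 (existence piece, strictly weaker than the crux, NOT known to decide the summit).**
Failure of the polyhedral Type-I Liouville theorem (route item #3, stmt-1405): a nontrivial bounded
ancient mild solution with Type-I decay, equivariant under a finite irreducible chiral `G`. -/
def ExistencePiece : Prop := ¬ QuantisedSymmetry.PolyhedralTypeILiouville

/-- **D2 (selection piece): ancient ⇒ scale-periodic.** From any such ancient solution, a discretely
self-similar one (a periodic orbit of the Leray semiflow) in the same class. Poincaré–Bendixson-type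
selection; false for general infinite-dimensional dissipative dynamics, no engine known here. -/
def SelectionPiece : Prop :=
  ¬ QuantisedSymmetry.PolyhedralTypeILiouville → QuantisedSymmetry.PolyhedralDssProfileExists

/-- **D3.** Assembly of the split (modus ponens). -/
theorem crux_of_pieces (hE : ExistencePiece) (hS : SelectionPiece) :
    QuantisedSymmetry.PolyhedralDssProfileExists :=
  hS hE

/-- The existence piece is implied by the crux (landed kill-switch glue
`quantisedSymmetry_liouvilleKillsProfile_proof`, stmt-1408), so it is a genuine weakening. -/
theorem existencePiece_of_crux (hX : QuantisedSymmetry.PolyhedralDssProfileExists) : ExistencePiece :=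
  fun hL =>
    _root_.Summit.NavierStokesRegularity.NavierStokesRegularity.Theorems.quantisedSymmetry_liouvilleKillsProfile_proof
      hL hX

/-- The selection piece is implied by the crux too (trivially), so `crux ↔ ExistencePiece ∧ SelectionPiece`. -/
theorem selectionPiece_of_crux (hX : QuantisedSymmetry.PolyhedralDssProfileExists) : SelectionPiece :=
  fun _ => hX

theorem crux_iff_pieces :
    QuantisedSymmetry.PolyhedralDssProfileExists ↔ ExistencePiece ∧ SelectionPiece :=
  ⟨fun hX => ⟨existencePiece_of_crux hX, selectionPiece_of_crux hX⟩, fun h => crux_of_pieces h.1 h.2⟩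

end Summit.NavierStokesRegularity.NavierStokesRegularity.Cruxes.PolyhedralDssProfileExists.S21g2
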